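import Literature.MathematicalPhysics.QuantumFieldTheory.Balaban1983to89.B4HolderLetterRegion
import Literature.MathematicalPhysics.QuantumFieldTheory.Balaban1983to89.B4Ineq19LpChain
import Literature.MathematicalPhysics.QuantumFieldTheory.Balaban1983to89.B4Lemma22HolderCubeField

/-!
# `Balaban1983to89.B4Thm19RegionLp` — [Balaban1983RegularityDecay] THEOREM p. 573, INEQUALITY (1.9) (THE HÖLDER
# MEMBER `|x−x′|^{−α}|U(A(Γ_{x,x′}))(D^η_{A,μ}G_k(Ω,A)f)(x′) − (D^η_{A,μ}G_k(Ω,A)f)(x)|`) FOR A GENERAL REGION `Ω` UNDER THE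
# PRINTED `R₀` RESTRICTION, END TO END, for a (1.7)-regular vector field and close pairs `32|x−x′|_∞ ≤ M` — r01 g6's
# mixed `L^p` chain `B4Ineq19LpChain.ineq19_holder_lp` with every structural hypothesis discharged on the cube data of
# `B4Thm110RegionLp`, the per-cube Hölder letter from `B4HolderLetterRegion.holder_letter_region` (η-UNIFORM)

statement-level skeleton of published theorems with citation tags; proofs where landed; nothing here is a claim about the Yang–Mills mass gap

WHAT THIS FILE DOES.  `B4Thm110RegionLp` / `B4Thm110RegionLpDeriv` proved the two members of (1.10) for a general
finite union `Ω` of `K`-blocks under `R₀`.  This file runs the print's route for the HÖLDER member (1.9), p. 573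
«|x − x′|^{−α}|U(A(Γ_{x,x′}))(D^η_{A,μ}G_k(Ω,A)f)(x′) − (D^η_{A,μ}G_k(Ω,A)f)(x)| ≦ c₀ exp(−δ₀ dist({x, x′}, supp f))‖f‖_∞»
(v1.1: quote restored verbatim — referee ref-1 g43 F4-nit; the theorems below take the decay through `D ≤ dist(x, supp f)`,
the stronger datum on close pairs):
* §1 `thm19_holder_region_of_inputs` — r01 g6's chain `ineq19_holder_lp_apply` for the probe
  `P_H = η^{-1}(η^{-1}|x−x′|_∞)^{−α}(E_{xy′}[U(A(Γ))U(A_{x′y′})] − E_{xx′}[U(A(Γ))] − (E_{xy}[U(A_{xy})] − E_{xx}[1]))`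
  with EVERY structural hypothesis discharged on [B4]'s data (as in `B4Thm110RegionLpDeriv`), the four chain inputs
  from `chain_letter_inputs`, and the per-cube Hölder letter `γ_H = √N(c_H + (d+1)D₁c_D + (d+3)s c_D + (d+1)(D₁²+D₂)c_G)`
  from `holder_letter_region` at every interior cube seeing one of `x, x+e_μ, x′, x′+e_μ` (the contour `Γ_{x,x′}`, a
  nearest-neighbour chain of length `≤ (d+1)|x−x′|_∞` staying within `|x−x′|_∞` of `x`, is read on the cube's box by
  `exists_chain_preimage`; close pairs `32|x−x′|_∞ ≤ ηM` put everything in the `¾M`-cores); the letter vanishes at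
  the cubes not seeing the four points.
* §2 **`thm19_holder_region`** — hypothesis-free: the inputs DISCHARGED by p35's Lemma 2.2 at `Ã_j` on the translated
  `2K`-boxes (`lemma22_sup_cubeField` (2.17) sup members, `B4Lemma22HolderCubeField.lemma22_holder_cubeField` (2.16)
  Hölder member, every `α < 1`), (2.20) `eq220_cubeField_std`, (2.21) `eq221_cubeField` / `eq221_psup_cubeField_std`,
  Lemma 2.1 `eq221_l2_region_hZ` at every cube, with «e sufficiently small» from `cubeField_threshold`, exactly as in
  `B4Thm110RegionLp.thm110_value_region`; `thm19_holder_region_unitBlock` for `f` supported in one unit block.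

HONEST SCOPE.  As `B4Thm110RegionLp` (abelian one-parameter flow = the print's (1.2), component field, staircase
contours on the cubes' boxes, `ℓ^∞` over sites and colours, the `L²`-comparison `V`; the cube size `K` = the print's
`M` chosen existentially after `d`, `N`, the flow's Lipschitz constant, `L`, the windows and `α`, so `δ₀ = 1/K` and
`R₀ = K(d+4)` inherit that dependence); CLOSE PAIRS ONLY (`32|x−x′|_∞ ≤ ηM` in lattice units, the print's «|x−x′| ≤ R₀»
up to the constant; far pairs follow from the derivative member twice, as in p17's `B4Thm19BoxHolderAll`, not done
here); the contour is any nearest-neighbour chain of length `≤ (d+1)|x−x′|_∞` within `|x−x′|_∞` of `x` (the print's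
«shortest contour»).  No `Prop` fact, no `sorry`; axioms standard.  v1.1 (r01 g8): module-docstring quote of (1.9) only; no
declaration changed.
-/

namespace Literature.MathematicalPhysics.QuantumFieldTheory.Balaban1983to89.B4Thm19RegionLp


open Literature.MathematicalPhysics.QuantumFieldTheory.Balaban1983to89.B4Reflection242 (boxDom mem_boxDom nbrs mem_nbrs
  blk blk_mem_boxDom)
open Literature.MathematicalPhysics.QuantumFieldTheory.Balaban1983to89.B4GaugeCovariance
open Literature.MathematicalPhysics.QuantumFieldTheory.Balaban1983to89.B4Commutators25to211 (mulH opK)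
open Literature.MathematicalPhysics.QuantumFieldTheory.Balaban1983to89.B4Lower18 (fineDom mem_fineDom IsBlockUnion)
open Literature.MathematicalPhysics.QuantumFieldTheory.Balaban1983to89.B4Lower18Regular (e1 baseEmb stairContour
  base_le_of_blk)
open Literature.MathematicalPhysics.QuantumFieldTheory.Balaban1983to89.B4Lower18RegularRegion (regWt rBlkWt rbaseEmb
  rstairContour regWt_nonneg rBlkWt_ne_zero compField)
open Literature.MathematicalPhysics.QuantumFieldTheory.Balaban1983to89.B4Lemma21Region (regionOp regionDeriv siteNorm
  covDeriv fld_covDeriv_mulVec_of_mem)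
open Literature.MathematicalPhysics.QuantumFieldTheory.Balaban1983to89.B4Lemma22ReduceZero (Box opA greenA derivA)
open Literature.MathematicalPhysics.QuantumFieldTheory.Balaban1983to89.B4Lemma22Reduce231 (supN supN_nonneg le_supN
  supN_le siteNorm_nonneg siteNorm_zero fld_add)
open Literature.MathematicalPhysics.QuantumFieldTheory.Balaban1983to89.B4Lemma22EtaBox (vol vol_pos lpW lpW_nonneg)
open Literature.MathematicalPhysics.QuantumFieldTheory.Balaban1983to89.B4Lemma22LpStair (lpM lpM_nonneg)
open Literature.MathematicalPhysics.QuantumFieldTheory.Balaban1983to89.B4PartitionUnity22 (hCube hCube_nonneg hCube_le_one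
  hCube_ne_zero_imp mem_box_of_hCube_ne_zero hprof D1 D2 D1_nonneg D2_nonneg contDiff_hprof hasCompactSupport_hprof)
open Literature.MathematicalPhysics.QuantumFieldTheory.Balaban1983to89.B4Eq220PartitionSizes (hZ hBox)
open Literature.MathematicalPhysics.QuantumFieldTheory.Balaban1983to89.B4Eq220CommutatorField (kOp)
open Literature.MathematicalPhysics.QuantumFieldTheory.Balaban1983to89.B4CubeFields22 (cubeField cubeField_eq_compField)
open Literature.MathematicalPhysics.QuantumFieldTheory.Balaban1983to89.B4CubeFieldHyps22 (aSeq_window cubeField_threshold)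
open Literature.MathematicalPhysics.QuantumFieldTheory.Balaban1983to89.B4Eq220CubeField (lemma22_sup_cubeField
  eq220_cubeField_std eq221_cubeField)
open Literature.MathematicalPhysics.QuantumFieldTheory.Balaban1983to89.B4Eq221PsupCubeField (eq221_psup_cubeField_std)
open Literature.MathematicalPhysics.QuantumFieldTheory.Balaban1983to89.B4Eq221L2FactorRegion (acBond kOpR)
open Literature.MathematicalPhysics.QuantumFieldTheory.Balaban1983to89.B4Eq221HjRegion (eq221_l2_region_hZ hsizeR_hZ)
open Literature.MathematicalPhysics.QuantumFieldTheory.Balaban1983to89.B4CubeOpReindex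
open Literature.MathematicalPhysics.QuantumFieldTheory.Balaban1983to89.B4WalkRouteRegion (rpos labels labels_complete
  regWt_local rBlkWt_local green_mul_op)
open Literature.MathematicalPhysics.QuantumFieldTheory.Balaban1983to89.B4Ineq110WalkRoute (norm_mulH_le)
open Literature.MathematicalPhysics.QuantumFieldTheory.Balaban1983to89.B4Ineq110WalkRouteDeriv (unitOp_apply
  unitOp_mul_mulH norm_unitOp_le fld_bondOp_mulVec)
open Literature.MathematicalPhysics.QuantumFieldTheory.Balaban1983to89.B4Thm110BoxDerivWalk (probe_mul_mulH
  fld_probe_mulVec_self fld_probe_mulVec_ne row_abs_sum_U_le)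
open Literature.MathematicalPhysics.QuantumFieldTheory.Balaban1983to89.B4RegionCubeCarrier
open Literature.MathematicalPhysics.QuantumFieldTheory.Balaban1983to89.B4CubeGreenRegion
open Literature.MathematicalPhysics.QuantumFieldTheory.Balaban1983to89.B4LpNormTransfer
open Literature.MathematicalPhysics.QuantumFieldTheory.Balaban1983to89.B4Thm110RegionLp
open Literature.MathematicalPhysics.QuantumFieldTheory.Balaban1983to89.B4Ineq110LpChain (lpv lpv_nonneg lvl lvl_zero
  lvl_succ lpv_two_le)
open Literature.MathematicalPhysics.QuantumFieldTheory.Balaban1983to89.B4Ineq19LpChain (ineq19_holder_lp_apply)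
open Literature.MathematicalPhysics.QuantumFieldTheory.Balaban1983to89.B4Ineq19WalkRoute (holderOp_mul_mulH)
open Literature.MathematicalPhysics.QuantumFieldTheory.Balaban1983to89.B4ContourShift (supNorm supNorm_nonneg abs_le_supNorm)
open Literature.MathematicalPhysics.QuantumFieldTheory.Balaban1983to89.B4Lemma22HolderBox (IsNNChain transport_fieldLink)
open Literature.MathematicalPhysics.QuantumFieldTheory.Balaban1983to89.B4HolderChainTools (one_le_supNorm_of_ne)
open Literature.MathematicalPhysics.QuantumFieldTheory.Balaban1983to89.B4Lemma22HolderCubeField (lemma22_holder_cubeField)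
open Literature.MathematicalPhysics.QuantumFieldTheory.Balaban1983to89.B4Thm110RegionLpDeriv (chain_letter_inputs)
open Literature.MathematicalPhysics.QuantumFieldTheory.Balaban1983to89.B4HolderLetterRegion
open scoped Matrix
open scoped Matrix.Norms.Operator

noncomputable section

variable {d : ℕ}

/-! ## §1. (1.9), Hölder member, on a general `Ω` from the per-cube inputs -/

section Inputs

variable {ι : Type} [Fintype ι] [DecidableEq ι]

omit [Fintype ι] [DecidableEq ι] in
/-- `|e_μ(ν)| ≤ 1`. [folklore] -/
private theorem abs_e1_cast_le (μ ν : Fin (d + 1)) : |((e1 μ ν : ℤ) : ℝ)| ≤ 1 := by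
  by_cases h : ν = μ
  · subst h; simp [B4Lower18Regular.e1_apply_self]
  · simp [B4Lower18Regular.e1_apply_ne h]

omit [Fintype ι] [DecidableEq ι] in
/-- two sites within `n·q` of each other coordinatewise have unit blocks within `q`. [folklore] -/
private theorem abs_blk_sub_blk_le {n : ℕ} (hn : 1 ≤ n) {u v : Fin (d + 1) → ℤ} {q : ℕ} (ν : Fin (d + 1))
    (h : ((|u ν - v ν| : ℤ) : ℝ) ≤ (n : ℝ) * q) : |blk n u ν - blk n v ν| ≤ q := by
  have hn0 : (0 : ℤ) < n := by exact_mod_cast hn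
  have h' : |u ν - v ν| ≤ (n : ℤ) * q := by exact_mod_cast h
  obtain ⟨h1, h2⟩ := abs_le.mp h'
  show |u ν / (n : ℤ) - v ν / (n : ℤ)| ≤ q
  rw [abs_le]
  constructor
  · have h3 : (v ν + (-(q : ℤ)) * (n : ℤ)) / (n : ℤ) ≤ u ν / (n : ℤ) := Int.ediv_le_ediv hn0 (by linarith)
    rw [Int.add_mul_ediv_right _ _ hn0.ne'] at h3
    linarith
  · have h3 : u ν / (n : ℤ) ≤ (v ν + (q : ℤ) * (n : ℤ)) / (n : ℤ) := Int.ediv_le_ediv hn0 (by linarith)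
    rw [Int.add_mul_ediv_right _ _ hn0.ne'] at h3
    linarith

/-- **THEOREM (1.9), HÖLDER MEMBER, ON A GENERAL REGION `Ω` UNDER `R₀`, CLOSE PAIRS, FROM THE PER-CUBE INPUTS** (every
structural hypothesis of r01 g6's chain `B4Ineq19LpChain.ineq19_holder_lp` DISCHARGED on [B4]'s concrete data; setting
of `B4Thm110RegionLpDeriv.thm110_deriv_region_of_inputs`).  INPUTS at the interior cubes, on the translated `2K`-boxes
at `Ã_j`: `‖G_k(□,Ã)Φ‖_∞ ≤ c_G‖Φ‖_∞`, `‖D^η_{Ã,ν}G_k(□,Ã)Φ‖_∞ ≤ c_D‖Φ‖_∞` (every `ν`) (2.17), the (2.16) Hölder member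
`(η^{-1}/|a−a′|_∞)^α|U(Ã(Γ))(D^η_{Ã,μ}GΦ)(a′) − (D^η_{Ã,μ}GΦ)(a)| ≤ c_H‖Φ‖_∞` for every pair and nearest-neighbour chain
of length `≤ (d+1)|a−a′|_∞` in the box, the (2.20)/(2.21) letters `≤ c_K·…`; at every cube Lemma 2.1's `‖·‖_{2,η}`
letter; `3^{d+1}√N c_K ≤ e^{−1}`.  The pair: `x ≠ x′`, both forward bonds in `Ω`, `32|x−x′|_∞ ≤ ηM` (`M = K` unit
blocks); the contour `Γ = (x, l)` a nearest-neighbour chain to `x′` of length `≤ (d+1)|x−x′|_∞` within `|x−x′|_∞` of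
`x`; `R₀` in label form with radius `K(n₀+3)`.  CONCLUSION for `f` supported in `P × ι` at `ℓ^∞`-distance `≥ D` from
`x` with `‖f‖_{2,η} ≤ V‖f‖_∞`:
`(η^{-1}/|x−x′|_∞)^α·|(U(A(Γ))(D^η_{A,μ}G_k(Ω,A)f)(x′) − (D^η_{A,μ}G_k(Ω,A)f)(x))_i| ≤ 2^{d+4}e^{5/2}·γ_H·V·e^{−D/(nK)}·‖f‖_∞`,
`γ_H = √N(c_H + (d+1)D₁c_D + (d+3)s c_D + (d+1)(D₁²+D₂)c_G)`, UNIFORM in `η`.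
[cite: Balaban1983RegularityDecay, Theorem (1.9) p.573; (1.3)–(1.4) p.572; (2.2)–(2.3) p.575; (2.13) p.577; (2.16)–(2.22) pp.578–579] -/
theorem thm19_holder_region_of_inputs (F : OrthFlow ι) (κ : ℝ) {ℓ k : ℕ} (hℓ : 1 ≤ ℓ) (hk : 1 ≤ k)
    (hn : 1 ≤ (ℓ + 1) ^ k) (Ωc : Finset (Fin (d + 1) → ℤ)) {K : ℕ} (hK16 : 16 ≤ K) (hK4 : 4 ∣ K) {a m2 : ℝ}
    (ha : 0 < a) (hm : 0 ≤ m2) (Ac : (Fin (d + 1) → ℤ) → Fin (d + 1) → ℝ) {cG cK : ℝ} (hcG : 0 ≤ cG) (hcK : 0 ≤ cK)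
    {n₀ : ℕ} (hn₀ : 0 < n₀)
    (hG : ∀ j, cubeLabels K j ⊆ Ωc → ∀ Φ : ↥(Box d ℓ k fun _ : Fin (d + 1) => 2 * K) × ι → ℝ,
      supN (greenA d F κ ℓ k a m2 (fun _ => 2 * K) (baseEmb hn _) (stairContour hn _) (boxFld ℓ k K Ac j) *ᵥ Φ)
        ≤ cG * supN Φ)
    (h0 : ∀ j, cubeLabels K j ⊆ Ωc → ∀ Φ : ↥(Box d ℓ k fun _ : Fin (d + 1) => 2 * K) × ι → ℝ,
      supN (kOp F κ ((ℓ + 1) ^ k) (B1.aSeq a ((ℓ : ℝ) + 1) k) m2 (fun _ => 2 * K) (baseEmb hn _) (stairContour hn _)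
            (boxFld ℓ k K Ac j) (hBox ((ℓ + 1) ^ k) K (fun _ => 2 * K) (fun _ => 1))
          *ᵥ (greenA d F κ ℓ k a m2 (fun _ => 2 * K) (baseEmb hn _) (stairContour hn _) (boxFld ℓ k K Ac j)
            *ᵥ (mulH (ι := ι) (hBox ((ℓ + 1) ^ k) K (fun _ => 2 * K) (fun _ => 1)) *ᵥ Φ))) ≤ cK * supN Φ)
    (h1 : ∀ j, cubeLabels K j ⊆ Ωc → ∀ p : ℝ, 2 * (n₀ : ℝ) ≤ p →
      ∀ Φ : ↥(Box d ℓ k fun _ : Fin (d + 1) => 2 * K) × ι → ℝ,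
      supN (kOp F κ ((ℓ + 1) ^ k) (B1.aSeq a ((ℓ : ℝ) + 1) k) m2 (fun _ => 2 * K) (baseEmb hn _) (stairContour hn _)
            (boxFld ℓ k K Ac j) (hBox ((ℓ + 1) ^ k) K (fun _ => 2 * K) (fun _ => 1))
          *ᵥ (greenA d F κ ℓ k a m2 (fun _ => 2 * K) (baseEmb hn _) (stairContour hn _) (boxFld ℓ k K Ac j)
            *ᵥ (mulH (ι := ι) (hBox ((ℓ + 1) ^ k) K (fun _ => 2 * K) (fun _ => 1)) *ᵥ Φ))) ≤ cK * lpW d ℓ k p Φ)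
    (hg : ∀ j, cubeLabels K j ⊆ Ωc → ∀ p q : ℝ, 1 ≤ p → p ≤ q → p⁻¹ - q⁻¹ ≤ (2 * (n₀ : ℝ))⁻¹ →
      ∀ Φ : ↥(Box d ℓ k fun _ : Fin (d + 1) => 2 * K) × ι → ℝ,
      lpW d ℓ k q (kOp F κ ((ℓ + 1) ^ k) (B1.aSeq a ((ℓ : ℝ) + 1) k) m2 (fun _ => 2 * K) (baseEmb hn _)
            (stairContour hn _) (boxFld ℓ k K Ac j) (hBox ((ℓ + 1) ^ k) K (fun _ => 2 * K) (fun _ => 1))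
          *ᵥ (greenA d F κ ℓ k a m2 (fun _ => 2 * K) (baseEmb hn _) (stairContour hn _) (boxFld ℓ k K Ac j)
            *ᵥ (mulH (ι := ι) (hBox ((ℓ + 1) ^ k) K (fun _ => 2 * K) (fun _ => 1)) *ᵥ Φ))) ≤ cK * lpW d ℓ k p Φ)
    (hb : ∀ (j : Fin (d + 1) → ℤ) (Φ : ↥(fineDom ((ℓ + 1) ^ k) (subLabels Ωc K j)) × ι → ℝ),
      lpW d ℓ k 2 (opK (regWt ((ℓ + 1) ^ k) (fineDom ((ℓ + 1) ^ k) (subLabels Ωc K j))) m2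
            (B1.aSeq a ((ℓ : ℝ) + 1) k * (((((ℓ + 1) ^ k : ℕ)) : ℝ) ^ (d + 1))⁻¹)
            (rBlkWt ((ℓ + 1) ^ k) (subLabels Ωc K j) (fineDom ((ℓ + 1) ^ k) (subLabels Ωc K j)))
            (fieldLink F κ (acBond (subLabels Ωc K j) Ac))
            (contourTrans (fieldLink F κ (acBond (subLabels Ωc K j) Ac)) (rbaseEmb hn (subLabels Ωc K j))
              (rstairContour hn (subLabels Ωc K j)))
            (fun a : ↥(fineDom ((ℓ + 1) ^ k) (subLabels Ωc K j)) => hZ ((ℓ + 1) ^ k) K j a.1)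
          *ᵥ ((covOp (regWt ((ℓ + 1) ^ k) (fineDom ((ℓ + 1) ^ k) (subLabels Ωc K j))) m2
                (B1.aSeq a ((ℓ : ℝ) + 1) k * (((((ℓ + 1) ^ k : ℕ)) : ℝ) ^ (d + 1))⁻¹)
                (rBlkWt ((ℓ + 1) ^ k) (subLabels Ωc K j) (fineDom ((ℓ + 1) ^ k) (subLabels Ωc K j)))
                (fieldLink F κ (acBond (subLabels Ωc K j) Ac))
                (contourTrans (fieldLink F κ (acBond (subLabels Ωc K j) Ac)) (rbaseEmb hn (subLabels Ωc K j))
                  (rstairContour hn (subLabels Ωc K j))))⁻¹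
            *ᵥ (mulH (ι := ι) (fun a : ↥(fineDom ((ℓ + 1) ^ k) (subLabels Ωc K j)) => hZ ((ℓ + 1) ^ k) K j a.1)
              *ᵥ Φ))) ≤ cK * lpW d ℓ k 2 Φ)
    {cD cH : ℝ} (hcD : 0 ≤ cD) (hcH : 0 ≤ cH) (μ : Fin (d + 1))
    (hDG : ∀ j, cubeLabels K j ⊆ Ωc → ∀ (ν : Fin (d + 1)) (Φ : ↥(Box d ℓ k fun _ : Fin (d + 1) => 2 * K) × ι → ℝ),
      supN (derivA d F κ ℓ k (fun _ => 2 * K) (boxFld ℓ k K Ac j) ν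
        *ᵥ (greenA d F κ ℓ k a m2 (fun _ => 2 * K) (baseEmb hn _) (stairContour hn _) (boxFld ℓ k K Ac j) *ᵥ Φ))
        ≤ cD * supN Φ)
    {α : ℝ} (hα0 : 0 ≤ α) (hα1 : α ≤ 1)
    (hHG : ∀ j, cubeLabels K j ⊆ Ωc → ∀ (a0 a0' : ↥(Box d ℓ k fun _ : Fin (d + 1) => 2 * K)),
      a0.1 + e1 μ ∈ Box d ℓ k (fun _ : Fin (d + 1) => 2 * K) → a0'.1 + e1 μ ∈ Box d ℓ k (fun _ : Fin (d + 1) => 2 * K) →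
      a0'.1 ≠ a0.1 → ∀ (lB : List ↥(Box d ℓ k fun _ : Fin (d + 1) => 2 * K)), IsNNChain a0 lB → pathEnd a0 lB = a0' →
      (lB.length : ℝ) ≤ ((d : ℝ) + 1) * supNorm (a0'.1 - a0.1) →
      ∀ Φ : ↥(Box d ℓ k fun _ : Fin (d + 1) => 2 * K) × ι → ℝ,
      ((((ℓ + 1) ^ k : ℕ) : ℝ) / supNorm (a0'.1 - a0.1)) ^ α *
        siteNorm (transport (fieldLink F κ (boxFld ℓ k K Ac j)) a0 lB
            *ᵥ fld (derivA d F κ ℓ k (fun _ => 2 * K) (boxFld ℓ k K Ac j) μ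
              *ᵥ (greenA d F κ ℓ k a m2 (fun _ => 2 * K) (baseEmb hn _) (stairContour hn _) (boxFld ℓ k K Ac j)
                *ᵥ Φ)) a0'
          - fld (derivA d F κ ℓ k (fun _ => 2 * K) (boxFld ℓ k K Ac j) μ
              *ᵥ (greenA d F κ ℓ k a m2 (fun _ => 2 * K) (baseEmb hn _) (stairContour hn _) (boxFld ℓ k K Ac j)
                *ᵥ Φ)) a0)
        ≤ cH * supN Φ)
    (h3 : (3 : ℝ) ^ (d + 1) * (Real.sqrt (Fintype.card ι) * cK) ≤ Real.exp (-1))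
    -- the pair, the bonds, the contour
    (x x' : ↥(fineDom ((ℓ + 1) ^ k) Ωc)) (hxμ : x.1 + e1 μ ∈ fineDom ((ℓ + 1) ^ k) Ωc)
    (hx'μ : x'.1 + e1 μ ∈ fineDom ((ℓ + 1) ^ k) Ωc) (hne : x'.1 ≠ x.1)
    (hclose : 32 * supNorm (x'.1 - x.1) ≤ (((ℓ + 1) ^ k : ℕ) : ℝ) * K)
    (l : List ↥(fineDom ((ℓ + 1) ^ k) Ωc)) (hl : IsNNChain x l) (hlend : pathEnd x l = x')
    (hlen : (l.length : ℝ) ≤ ((d : ℝ) + 1) * supNorm (x'.1 - x.1))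
    (hlnear : ∀ z ∈ l, supNorm (z.1 - x.1) ≤ supNorm (x'.1 - x.1))
    (hR₀ : ∀ y : Fin (d + 1) → ℤ, (∀ ν, |y ν - blk ((ℓ + 1) ^ k) x.1 ν| ≤ (K : ℤ) * (n₀ + 3)) → y ∈ Ωc)
    -- the source
    (P : ↥(fineDom ((ℓ + 1) ^ k) Ωc) → Prop) [DecidablePred P] {D : ℝ}
    (hD : ∀ x'', P x'' → ∃ ν, D ≤ |rpos ((ℓ + 1) ^ k) Ωc x ν - rpos ((ℓ + 1) ^ k) Ωc x'' ν|)
    (f : ↥(fineDom ((ℓ + 1) ^ k) Ωc) × ι → ℝ) (hfP : ∀ p, ¬ P p.1 → f p = 0) {V : ℝ} (hV : 1 ≤ V)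
    (hfV : lpv (vol d ℓ k)⁻¹ 2 f ≤ V * ‖f‖) (i : ι) :
    ((((ℓ + 1) ^ k : ℕ) : ℝ) / supNorm (x'.1 - x.1)) ^ α *
      |(transport (fieldLink F κ (acBond Ωc Ac)) x l
          *ᵥ fld (covDeriv ((ℓ + 1) ^ k) (fineDom ((ℓ + 1) ^ k) Ωc) (fieldLink F κ (acBond Ωc Ac)) μ
              *ᵥ ((covOp (regWt ((ℓ + 1) ^ k) (fineDom ((ℓ + 1) ^ k) Ωc)) m2
                (B1.aSeq a ((ℓ : ℝ) + 1) k * (((((ℓ + 1) ^ k : ℕ)) : ℝ) ^ (d + 1))⁻¹)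
                (rBlkWt ((ℓ + 1) ^ k) Ωc (fineDom ((ℓ + 1) ^ k) Ωc)) (fieldLink F κ (acBond Ωc Ac))
                (contourTrans (fieldLink F κ (acBond Ωc Ac)) (rbaseEmb hn Ωc) (rstairContour hn Ωc)))⁻¹ *ᵥ f)) x'
        - fld (covDeriv ((ℓ + 1) ^ k) (fineDom ((ℓ + 1) ^ k) Ωc) (fieldLink F κ (acBond Ωc Ac)) μ
              *ᵥ ((covOp (regWt ((ℓ + 1) ^ k) (fineDom ((ℓ + 1) ^ k) Ωc)) m2
                (B1.aSeq a ((ℓ : ℝ) + 1) k * (((((ℓ + 1) ^ k : ℕ)) : ℝ) ^ (d + 1))⁻¹)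
                (rBlkWt ((ℓ + 1) ^ k) Ωc (fineDom ((ℓ + 1) ^ k) Ωc)) (fieldLink F κ (acBond Ωc Ac))
                (contourTrans (fieldLink F κ (acBond Ωc Ac)) (rbaseEmb hn Ωc) (rstairContour hn Ωc)))⁻¹ *ᵥ f)) x) i|
      ≤ 2 ^ (d + 4) * Real.exp (5 / 2)
          * (Real.sqrt (Fintype.card ι) * (cH + ((d : ℝ) + 1) * D1 hprof * cD
              + ((d : ℝ) + 3) * (((d : ℝ) + 1) * (D1 hprof + D2 hprof)) * cD
              + ((d : ℝ) + 1) * (D1 hprof ^ 2 + D2 hprof) * cG))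
          * V * Real.exp (-(D / ((((ℓ + 1) ^ k : ℕ) : ℝ) * K))) * ‖f‖ := by
  classical
  -- scalars
  have hK8 : 8 ≤ K := le_trans (by norm_num) hK16
  have hK1 : 1 ≤ K := le_trans (by norm_num) hK16
  have hn2 : 2 ≤ (ℓ + 1) ^ k := by
    calc 2 ≤ ℓ + 1 := by omega
      _ = (ℓ + 1) ^ 1 := (pow_one _).symm
      _ ≤ (ℓ + 1) ^ k := Nat.pow_le_pow_right (Nat.succ_pos ℓ) hk
  have hnK3 : 3 ≤ (ℓ + 1) ^ k * K := le_trans (by norm_num) (Nat.mul_le_mul hn2 hK8)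
  have hnr1 : (1 : ℝ) ≤ ((((ℓ + 1) ^ k : ℕ)) : ℝ) := by exact_mod_cast hn
  have hnr : (0 : ℝ) < ((((ℓ + 1) ^ k : ℕ)) : ℝ) := by linarith
  have hnr2 : (2 : ℝ) ≤ ((((ℓ + 1) ^ k : ℕ)) : ℝ) := by exact_mod_cast hn2
  have hKr : (1 : ℝ) ≤ K := by exact_mod_cast hK1
  have hK16r : (16 : ℝ) ≤ K := by exact_mod_cast hK16
  have hKpos : (0 : ℝ) < K := by positivity
  have hM : (0 : ℝ) < ((((ℓ + 1) ^ k : ℕ)) : ℝ) * K := by positivity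
  have hnK32 : (32 : ℝ) ≤ ((((ℓ + 1) ^ k : ℕ)) : ℝ) * K := by nlinarith
  have hL : (1 : ℝ) < (ℓ : ℝ) + 1 := by
    have : (1 : ℝ) ≤ ℓ := by exact_mod_cast hℓ
    linarith
  have hak : 0 < B1.aSeq a ((ℓ : ℝ) + 1) k := B1.aSeq_pos ha hL hk
  have hak' : 0 < B1.aSeq a ((ℓ : ℝ) + 1) k * (((((ℓ + 1) ^ k : ℕ)) : ℝ) ^ (d + 1))⁻¹ := by positivity
  have hw : (0 : ℝ) < (vol d ℓ k)⁻¹ := inv_pos.2 (vol_pos d ℓ k)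
  have hD1 := D1_nonneg contDiff_hprof hasCompactSupport_hprof
  have hD2 := D2_nonneg contDiff_hprof hasCompactSupport_hprof
  -- the four chain inputs
  obtain ⟨-, H0, Hgr, H2⟩ := chain_letter_inputs F κ hℓ hk hn Ωc hK8 ha hm Ac hcG hcK hn₀ hG h0 h1 hg hb
  -- the Hölder weight
  set r : ℝ := supNorm (x'.1 - x.1) with hr_def
  have hr1 : 1 ≤ r := one_le_supNorm_of_ne hne
  have hr0 : 0 ≤ r := by linarith
  have hrK : r ≤ ((((ℓ + 1) ^ k : ℕ)) : ℝ) * K := by linarith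
  set w : ℝ := (((((ℓ + 1) ^ k : ℕ)) : ℝ) / r) ^ α with hw_def
  have hw0 : 0 ≤ w := Real.rpow_nonneg (div_nonneg hnr.le hr0) α
  -- the bond end points and the probe data
  set y : ↥(fineDom ((ℓ + 1) ^ k) Ωc) := ⟨x.1 + e1 μ, hxμ⟩ with hy
  set y' : ↥(fineDom ((ℓ + 1) ^ k) Ωc) := ⟨x'.1 + e1 μ, hx'μ⟩ with hy'
  set hh : (Fin (d + 1) → ℤ) → ↥(fineDom ((ℓ + 1) ^ k) Ωc) → ℝ :=
    fun j z => hCube (((((ℓ + 1) ^ k : ℕ)) : ℝ) * K) j (rpos ((ℓ + 1) ^ k) Ωc z) with hhh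
  -- integer distances to `x`: every relevant point is within `r + 1`
  have dx : ∀ ν, |((x.1 ν : ℤ) : ℝ) - x.1 ν| ≤ r + 1 := fun ν => by rw [sub_self, abs_zero]; linarith
  have dy : ∀ ν, |((y.1 ν : ℤ) : ℝ) - x.1 ν| ≤ r + 1 := fun ν => by
    rw [hy]; simp only [Pi.add_apply, Int.cast_add, add_sub_cancel_left]
    exact (abs_e1_cast_le μ ν).trans (by linarith)
  have dx' : ∀ ν, |((x'.1 ν : ℤ) : ℝ) - x.1 ν| ≤ r + 1 := fun ν => by
    have h := abs_le_supNorm (x'.1 - x.1) ν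
    rw [Pi.sub_apply, Int.cast_abs, Int.cast_sub] at h
    exact h.trans (by linarith)
  have dy' : ∀ ν, |((y'.1 ν : ℤ) : ℝ) - x.1 ν| ≤ r + 1 := fun ν => by
    rw [hy']; simp only [Pi.add_apply, Int.cast_add]
    have h := abs_le_supNorm (x'.1 - x.1) ν
    rw [Pi.sub_apply, Int.cast_abs, Int.cast_sub] at h
    calc |((x'.1 ν : ℤ) : ℝ) + ((e1 μ ν : ℤ) : ℝ) - x.1 ν| = |(((x'.1 ν : ℤ) : ℝ) - x.1 ν) + ((e1 μ ν : ℤ) : ℝ)| := by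
          ring_nf
      _ ≤ |((x'.1 ν : ℤ) : ℝ) - x.1 ν| + |((e1 μ ν : ℤ) : ℝ)| := abs_add_le _ _
      _ ≤ r + 1 := add_le_add h (abs_e1_cast_le μ ν)
  have dl : ∀ z ∈ l, ∀ ν, |((z.1 ν : ℤ) : ℝ) - x.1 ν| ≤ r + 1 := fun z hz ν => by
    have h := abs_le_supNorm (z.1 - x.1) ν
    rw [Pi.sub_apply, Int.cast_abs, Int.cast_sub] at h
    exact h.trans ((hlnear z hz).trans (by linarith))
  -- pairs of relevant points are within `M/8`
  have hclose' : 2 * r + 2 ≤ 1 / 8 * (((((ℓ + 1) ^ k : ℕ)) : ℝ) * K) := by nlinarith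
  have hpair : ∀ (p q : ↥(fineDom ((ℓ + 1) ^ k) Ωc)), (∀ ν, |((p.1 ν : ℤ) : ℝ) - x.1 ν| ≤ r + 1) →
      (∀ ν, |((q.1 ν : ℤ) : ℝ) - x.1 ν| ≤ r + 1) →
      ∀ ν, |rpos ((ℓ + 1) ^ k) Ωc q ν - rpos ((ℓ + 1) ^ k) Ωc p ν| ≤ 1 / 8 * (((((ℓ + 1) ^ k : ℕ)) : ℝ) * K) := by
    intro p q hp hq ν
    show |((q.1 ν : ℤ) : ℝ) - ((p.1 ν : ℤ) : ℝ)| ≤ _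
    calc |((q.1 ν : ℤ) : ℝ) - p.1 ν| = |(((q.1 ν : ℤ) : ℝ) - x.1 ν) - (((p.1 ν : ℤ) : ℝ) - x.1 ν)| := by ring_nf
      _ ≤ |((q.1 ν : ℤ) : ℝ) - x.1 ν| + |((p.1 ν : ℤ) : ℝ) - x.1 ν| := abs_sub _ _
      _ ≤ 2 * r + 2 := by linarith [hp ν, hq ν]
      _ ≤ 1 / 8 * (((((ℓ + 1) ^ k : ℕ)) : ℝ) * K) := hclose'
  have hxy : ∀ ν, |rpos ((ℓ + 1) ^ k) Ωc x ν - rpos ((ℓ + 1) ^ k) Ωc y ν| ≤ 1 / 8 * (((((ℓ + 1) ^ k : ℕ)) : ℝ) * K) := hpair y x dy dx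
  have hxx' : ∀ ν, |rpos ((ℓ + 1) ^ k) Ωc x ν - rpos ((ℓ + 1) ^ k) Ωc x' ν| ≤ 1 / 8 * (((((ℓ + 1) ^ k : ℕ)) : ℝ) * K) := hpair x' x dx' dx
  have hx'y' : ∀ ν, |rpos ((ℓ + 1) ^ k) Ωc x' ν - rpos ((ℓ + 1) ^ k) Ωc y' ν| ≤ 1 / 8 * (((((ℓ + 1) ^ k : ℕ)) : ℝ) * K) :=
    hpair y' x' dy' dx'
  -- the per-cube Hölder input
  set γH : ℝ := Real.sqrt (Fintype.card ι) * (cH + ((d : ℝ) + 1) * D1 hprof * cD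
      + ((d : ℝ) + 3) * (((d : ℝ) + 1) * (D1 hprof + D2 hprof)) * cD
      + ((d : ℝ) + 1) * (D1 hprof ^ 2 + D2 hprof) * cG) with hγH_def
  have hγH0 : 0 ≤ γH := by rw [hγH_def]; positivity
  have hγH : ∀ jj : ↥(labels (((((ℓ + 1) ^ k : ℕ)) : ℝ) * K) ((ℓ + 1) ^ k) Ωc), cubeLabels K jj.1 ⊆ Ωc →
      ‖(((((ℓ + 1) ^ k : ℕ)) : ℝ) * w) • (unitOp x y' ((transport (fieldLink F κ (acBond Ωc Ac)) x l) * (fieldLink F κ (acBond Ωc Ac)) x' y') - unitOp x x' (transport (fieldLink F κ (acBond Ωc Ac)) x l) - (unitOp x y ((fieldLink F κ (acBond Ωc Ac)) x y) - unitOp x x 1))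
        * (mulH (ι := ι) (hh jj.1) * atGreen F κ ℓ k Ωc K Ac a m2 jj.1 * mulH (ι := ι) (hh jj.1))‖ ≤ γH := by
    intro jj hgj
    by_cases hzero : hh jj.1 x = 0 ∧ hh jj.1 y = 0 ∧ hh jj.1 x' = 0 ∧ hh jj.1 y' = 0
    · -- the probe does not see `h_j`: the letter vanishes
      obtain ⟨e1', e2', e3', e4'⟩ := hzero
      rw [← Matrix.mul_assoc, ← Matrix.mul_assoc, holderOp_mul_mulH, e1', e2', e3', e4']
      simp only [zero_smul, sub_self, smul_zero, Matrix.zero_mul, norm_zero]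
      exact hγH0
    · -- some of the four points is seen by `h_j`: everything is in the `¾M`-core of `□_j`
      have hseen : ∃ p : ↥(fineDom ((ℓ + 1) ^ k) Ωc), hh jj.1 p ≠ 0 ∧ ∀ ν, |((p.1 ν : ℤ) : ℝ) - x.1 ν| ≤ r + 1 := by
        by_cases a1 : hh jj.1 x = 0
        · by_cases a2 : hh jj.1 y = 0
          · by_cases a3 : hh jj.1 x' = 0
            · have a4 : hh jj.1 y' ≠ 0 := fun a4 => hzero ⟨a1, a2, a3, a4⟩
              exact ⟨y', a4, dy'⟩
            · exact ⟨x', a3, dx'⟩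
          · exact ⟨y, a2, dy⟩
        · exact ⟨x, a1, dx⟩
      obtain ⟨p, hp, dp⟩ := hseen
      have hpl : ∀ q : ↥(fineDom ((ℓ + 1) ^ k) Ωc), (∀ ν, |((q.1 ν : ℤ) : ℝ) - x.1 ν| ≤ r + 1) →
          ∀ ν, |rpos ((ℓ + 1) ^ k) Ωc q ν - (((((ℓ + 1) ^ k : ℕ)) : ℝ) * K) * jj.1 ν| ≤ 3 / 4 * (((((ℓ + 1) ^ k : ℕ)) : ℝ) * K) := by
        intro q hq ν
        have h1 := hCube_ne_zero_imp hM hp ν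
        have h2 := hpair p q dp hq ν
        calc |rpos ((ℓ + 1) ^ k) Ωc q ν - (((((ℓ + 1) ^ k : ℕ)) : ℝ) * K) * jj.1 ν|
            ≤ |rpos ((ℓ + 1) ^ k) Ωc q ν - rpos ((ℓ + 1) ^ k) Ωc p ν|
              + |rpos ((ℓ + 1) ^ k) Ωc p ν - (((((ℓ + 1) ^ k : ℕ)) : ℝ) * K) * jj.1 ν| := abs_sub_le _ _ _
          _ ≤ 1 / 8 * (((((ℓ + 1) ^ k : ℕ)) : ℝ) * K) + 5 / 8 * (((((ℓ + 1) ^ k : ℕ)) : ℝ) * K) := add_le_add h2 h1.le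
          _ = 3 / 4 * (((((ℓ + 1) ^ k : ℕ)) : ℝ) * K) := by ring
      -- the four points and the contour read on the box of `□_j`
      have hE := boxEmb_injective ℓ k (fun _ => 2 * K) (cshift K jj.1) (shift_mem_of_cube_subset hgj)
      have hpre : ∀ q : ↥(fineDom ((ℓ + 1) ^ k) Ωc), (∀ ν, |((q.1 ν : ℤ) : ℝ) - x.1 ν| ≤ r + 1) →
          ∃ c, boxEmb ℓ k (fun _ => 2 * K) (cshift K jj.1) (shift_mem_of_cube_subset hgj) c = q :=
        fun q hq => (cubeS_iff_boxEmb ℓ k Ωc K hgj q).1 (cubeS_of_core ℓ k Ωc hK1 jj.1 q (hpl q hq))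
      obtain ⟨a0, ha0⟩ := hpre x dx
      obtain ⟨b0, hb0⟩ := hpre y dy
      obtain ⟨lB, hlB, hchB, hendB, hlenB⟩ := exists_chain_preimage ℓ k (fun _ => 2 * K) (cshift K jj.1)
        (shift_mem_of_cube_subset hgj) x l a0 ha0 hl fun z hz => hpre z (dl z hz)
      set a0' := pathEnd a0 lB with ha0'_def
      have ha0' : boxEmb ℓ k (fun _ => 2 * K) (cshift K jj.1) (shift_mem_of_cube_subset hgj) a0' = x' := by
        rw [ha0'_def, hendB, hlend]
      obtain ⟨b0', hb0'⟩ := hpre y' dy'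
      -- the forward bonds on the box
      have hshift : ∀ (c c' : ↥(Box d ℓ k fun _ : Fin (d + 1) => 2 * K)) (z z' : ↥(fineDom ((ℓ + 1) ^ k) Ωc)),
          boxEmb ℓ k (fun _ => 2 * K) (cshift K jj.1) (shift_mem_of_cube_subset hgj) c = z →
          boxEmb ℓ k (fun _ => 2 * K) (cshift K jj.1) (shift_mem_of_cube_subset hgj) c' = z' →
          z'.1 = z.1 + e1 μ → c'.1 = c.1 + e1 μ := by
        intro c c' z z' hc hc' hzz'
        have h1 : c'.1 + (fun i => (((ℓ + 1) ^ k : ℕ) : ℤ) * cshift K jj.1 i) = z'.1 := congrArg Subtype.val hc'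
        have h2 : c.1 + (fun i => (((ℓ + 1) ^ k : ℕ) : ℤ) * cshift K jj.1 i) = z.1 := congrArg Subtype.val hc
        have h3 : c'.1 + (fun i => (((ℓ + 1) ^ k : ℕ) : ℤ) * cshift K jj.1 i)
            = (c.1 + e1 μ) + (fun i => (((ℓ + 1) ^ k : ℕ) : ℤ) * cshift K jj.1 i) := by
          rw [h1, hzz', ← h2]; abel
        exact add_right_cancel h3
      have hba : b0.1 = a0.1 + e1 μ := hshift a0 b0 x y ha0 hb0 rfl
      have hba' : b0'.1 = a0'.1 + e1 μ := hshift a0' b0' x' y' ha0' hb0' rfl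
      have ha0μ : a0.1 + e1 μ ∈ Box d ℓ k (fun _ : Fin (d + 1) => 2 * K) := hba ▸ b0.2
      have ha0'μ : a0'.1 + e1 μ ∈ Box d ℓ k (fun _ : Fin (d + 1) => 2 * K) := hba' ▸ b0'.2
      have hyB : boxEmb ℓ k (fun _ => 2 * K) (cshift K jj.1) (shift_mem_of_cube_subset hgj) ⟨a0.1 + e1 μ, ha0μ⟩ = y := by
        rw [← hb0]; congr 1; exact Subtype.ext hba.symm
      have hy'B : boxEmb ℓ k (fun _ => 2 * K) (cshift K jj.1) (shift_mem_of_cube_subset hgj) ⟨a0'.1 + e1 μ, ha0'μ⟩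
          = y' := by
        rw [← hb0']; congr 1; exact Subtype.ext hba'.symm
      have hsubB : a0'.1 - a0.1 = x'.1 - x.1 := by rw [← ha0, ← ha0', boxEmb_sub_boxEmb]
      have hneB : a0'.1 ≠ a0.1 := fun h => hne (by
        have h2 := hsubB
        rw [h, sub_self] at h2
        exact (sub_eq_zero.mp h2.symm))
      have hlenB' : (lB.length : ℝ) ≤ ((d : ℝ) + 1) * supNorm (a0'.1 - a0.1) := by rw [hlenB, hsubB]; exact hlen
      have hcore : ∀ z : ↥(fineDom ((ℓ + 1) ^ k) Ωc), (z = x ∨ z = y ∨ z = x' ∨ z = y' ∨ z ∈ l) →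
          ∀ ν, |rpos ((ℓ + 1) ^ k) Ωc z ν - ((((ℓ + 1) ^ k : ℕ) : ℝ) * K) * jj.1 ν|
            ≤ 3 / 4 * ((((ℓ + 1) ^ k : ℕ) : ℝ) * K) := by
        intro z hz
        rcases hz with rfl | rfl | rfl | rfl | hz
        · exact hpl _ dx
        · exact hpl _ dy
        · exact hpl _ dx'
        · exact hpl _ dy'
        · exact hpl _ (dl z hz)
      have hmain := holder_letter_region F κ hn Ωc hK1 hnK3 Ac a m2 hgj hcG hcD hcH (hG jj.1 hgj) (hDG jj.1 hgj) μ a0 a0'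
        ha0μ ha0'μ hneB lB hchB rfl hlenB' hα0 hα1
        (hHG jj.1 hgj a0 a0' ha0μ ha0'μ hneB lB hchB rfl hlenB') x y x' y' l ha0 hyB ha0' hy'B hlB hrK hcore
      exact hmain
  -- `R₀`: the cubes seeing one of the four points and their `n₀`-neighbours are interior
  have hblk : ∀ p : ↥(fineDom ((ℓ + 1) ^ k) Ωc), (∀ ν, |((p.1 ν : ℤ) : ℝ) - x.1 ν| ≤ r + 1) →
      ∀ ν, |blk ((ℓ + 1) ^ k) p.1 ν - blk ((ℓ + 1) ^ k) x.1 ν| ≤ (K : ℤ) := by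
    intro p hp ν
    refine abs_blk_sub_blk_le hn ν ?_
    rw [Int.cast_abs, Int.cast_sub]
    exact (hp ν).trans (by linarith)
  have hRp : ∀ p : ↥(fineDom ((ℓ + 1) ^ k) Ωc), (∀ ν, |((p.1 ν : ℤ) : ℝ) - x.1 ν| ≤ r + 1) →
      ∀ y'' : Fin (d + 1) → ℤ, (∀ ν, |y'' ν - blk ((ℓ + 1) ^ k) p.1 ν| ≤ (K : ℤ) * (n₀ + 2)) → y'' ∈ Ωc := by
    intro p hp y'' hy''
    refine hR₀ y'' fun ν => ?_
    calc |y'' ν - blk ((ℓ + 1) ^ k) x.1 ν|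
        = |(y'' ν - blk ((ℓ + 1) ^ k) p.1 ν) + (blk ((ℓ + 1) ^ k) p.1 ν - blk ((ℓ + 1) ^ k) x.1 ν)| := by ring_nf
      _ ≤ |y'' ν - blk ((ℓ + 1) ^ k) p.1 ν| + |blk ((ℓ + 1) ^ k) p.1 ν - blk ((ℓ + 1) ^ k) x.1 ν| := abs_add_le _ _
      _ ≤ (K : ℤ) * (n₀ + 2) + K := add_le_add (hy'' ν) (hblk p hp ν)
      _ = (K : ℤ) * (n₀ + 3) := by ring
  have hR₀' : ∀ i ∈ labels (((((ℓ + 1) ^ k : ℕ)) : ℝ) * K) ((ℓ + 1) ^ k) Ωc,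
      (hh i x ≠ 0 ∨ hh i y ≠ 0 ∨ hh i x' ≠ 0 ∨ hh i y' ≠ 0) →
      ∀ j ∈ labels (((((ℓ + 1) ^ k : ℕ)) : ℝ) * K) ((ℓ + 1) ^ k) Ωc, (∀ ν, |i ν - j ν| ≤ (n₀ : ℤ)) → cubeLabels K j ⊆ Ωc := by
    intro i _ hi j _ hij
    rcases hi with h1 | h2 | h3 | h4
    · exact good_of_R0 ℓ k Ωc hK8 n₀ x (hRp x dx) i h1 j hij
    · exact good_of_R0 ℓ k Ωc hK8 n₀ y (hRp y dy) i h2 j hij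
    · exact good_of_R0 ℓ k Ωc hK8 n₀ x' (hRp x' dx') i h3 j hij
    · exact good_of_R0 ℓ k Ωc hK8 n₀ y' (hRp y' dy') i h4 j hij
  -- THE CHAIN
  have main := ineq19_holder_lp_apply (X := ↥(fineDom ((ℓ + 1) ^ k) Ωc)) (Y := ↥Ωc) (κ := ι) hM
    (rpos ((ℓ + 1) ^ k) Ωc) (regWt ((ℓ + 1) ^ k) (fineDom ((ℓ + 1) ^ k) Ωc)) m2
    (B1.aSeq a ((ℓ : ℝ) + 1) k * (((((ℓ + 1) ^ k : ℕ)) : ℝ) ^ (d + 1))⁻¹)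
    (rBlkWt ((ℓ + 1) ^ k) Ωc (fineDom ((ℓ + 1) ^ k) Ωc)) (fieldLink F κ (acBond Ωc Ac))
    (contourTrans (fieldLink F κ (acBond Ωc Ac)) (rbaseEmb hn Ωc) (rstairContour hn Ωc))
    (fun x z' h μ => regWt_local hn Ωc hK8 x z' h μ)
    (fun y x z' h h' μ => rBlkWt_local hn Ωc hK8 y x z' h h' μ)
    (labels (((((ℓ + 1) ^ k : ℕ)) : ℝ) * K) ((ℓ + 1) ^ k) Ωc) (fun j z h => labels_complete Ωc _ j z h)
    (fun j => cubeS ℓ k Ωc K j) (fun j z hz => inBox_of_near hn hK1 j z hz)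
    (fun j => cubeW F κ ℓ k Ωc K (atField ℓ k Ωc K Ac j) j)
    (fun j => cubeT F κ ℓ k Ωc K (atField ℓ k Ωc K Ac j) j)
    (fun j x z' hx hz' => cubeW_window F κ ℓ k Ωc hK1 j hx hz' (atField_core ℓ k Ωc Ac hK1 j x z' hx hz'))
    (fun j y x hyx hx => cubeT_window F κ ℓ k Ωc hK1 hK4 j
      (fun u v hu hv _ => atField_core ℓ k Ωc Ac hK1 j u v hu hv) y x hyx hx)
    (atGreen F κ ℓ k Ωc K Ac a m2)
    (fun j _ => atGreen_mul F κ ℓ k Ωc K Ac hℓ hk ha hm j)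
    _ (green_mul_op hn Ωc F κ hak' hm (regWt ((ℓ + 1) ^ k) (fineDom ((ℓ + 1) ^ k) Ωc)) (regWt_nonneg _ _)
      (fun _ _ _ => rfl) (acBond Ωc Ac))
    x y x' y' hxy hxx' hx'y' (((((ℓ + 1) ^ k : ℕ)) : ℝ) * w) (transport (fieldLink F κ (acBond Ωc Ac)) x l) (fun j => cubeLabels K j ⊆ Ωc)
    (β := Real.sqrt (Fintype.card ι) * cK) (ω := (vol d ℓ k)⁻¹) hn₀ hw hγH0 (by positivity) hγH
    (fun jj hj => H0 jj.1 hj) (fun jj hj => Hgr jj.1 hj) (fun jj g => H2 jj.1 g) h3 hR₀' P hD f hfP hV hfV i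
  -- identify the probe's value with the Hölder quotient of `D^η_{A,μ}G f`
  set Ψ := (covOp (regWt ((ℓ + 1) ^ k) (fineDom ((ℓ + 1) ^ k) Ωc)) m2
      (B1.aSeq a ((ℓ : ℝ) + 1) k * (((((ℓ + 1) ^ k : ℕ)) : ℝ) ^ (d + 1))⁻¹)
      (rBlkWt ((ℓ + 1) ^ k) Ωc (fineDom ((ℓ + 1) ^ k) Ωc)) (fieldLink F κ (acBond Ωc Ac))
      (contourTrans (fieldLink F κ (acBond Ωc Ac)) (rbaseEmb hn Ωc) (rstairContour hn Ωc)))⁻¹ *ᵥ f with hΨ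
  have hderiv : ∀ (u : ↥(fineDom ((ℓ + 1) ^ k) Ωc)) (hu : u.1 + e1 μ ∈ fineDom ((ℓ + 1) ^ k) Ωc),
      (fieldLink F κ (acBond Ωc Ac)) u ⟨u.1 + e1 μ, hu⟩ *ᵥ fld Ψ ⟨u.1 + e1 μ, hu⟩ - fld Ψ u
        = ((((ℓ + 1) ^ k : ℕ)) : ℝ)⁻¹ • fld (covDeriv ((ℓ + 1) ^ k) (fineDom ((ℓ + 1) ^ k) Ωc) (fieldLink F κ (acBond Ωc Ac)) μ *ᵥ Ψ) u := by
    intro u hu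
    rw [fld_covDeriv_mulVec_of_mem ((ℓ + 1) ^ k) (fieldLink F κ (acBond Ωc Ac)) Ψ hu, smul_smul, inv_mul_cancel₀ hnr.ne', one_smul]
  have hid : (((((ℓ + 1) ^ k : ℕ)) : ℝ) * w) • ((transport (fieldLink F κ (acBond Ωc Ac)) x l) *ᵥ ((fieldLink F κ (acBond Ωc Ac)) x' y' *ᵥ fld Ψ y' - fld Ψ x') - ((fieldLink F κ (acBond Ωc Ac)) x y *ᵥ fld Ψ y - fld Ψ x))
      = w • ((transport (fieldLink F κ (acBond Ωc Ac)) x l) *ᵥ fld (covDeriv ((ℓ + 1) ^ k) (fineDom ((ℓ + 1) ^ k) Ωc) (fieldLink F κ (acBond Ωc Ac)) μ *ᵥ Ψ) x'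
          - fld (covDeriv ((ℓ + 1) ^ k) (fineDom ((ℓ + 1) ^ k) Ωc) (fieldLink F κ (acBond Ωc Ac)) μ *ᵥ Ψ) x) := by
    rw [hy, hy', hderiv x' hx'μ, hderiv x hxμ, Matrix.mulVec_smul, ← smul_sub, smul_smul,
      show ((((ℓ + 1) ^ k : ℕ)) : ℝ) * w * ((((ℓ + 1) ^ k : ℕ)) : ℝ)⁻¹ = w by field_simp]
  rw [hid, Pi.smul_apply, smul_eq_mul, abs_mul, abs_of_nonneg hw0] at main
  exact main

end Inputs

/-! ## §2. THE THEOREM (1.9), Hölder member, for a general `Ω` under `R₀` — hypothesis-free -/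

section Main

variable {ι : Type} [Fintype ι] [DecidableEq ι]

/-- **THEOREM p. 573, INEQUALITY (1.9) — the HÖLDER member — FOR A GENERAL REGION `Ω` UNDER THE `R₀` RESTRICTION, CLOSE
PAIRS, for a (1.7)-regular vector field, with only «e sufficiently small», UNIFORM IN `η`** (the print's own route as in
`B4Thm110RegionLp.thm110_value_region`; the per-cube Hölder letter by `B4HolderLetterRegion.holder_letter_region`, its
inputs by p35's Lemma 2.2 at `Ã_j`: (2.17) sup members `lemma22_sup_cubeField`, (2.16) Hölder member
`lemma22_holder_cubeField`).  For every `α < 1` there are a cube size `K ≥ 16` (`8 ∣ K`) and `c₀ > 0` (depending on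
`d`, `N`, the flow, `L`, the windows and `α`) such that for every `(c, β)`, `β > 0`, there is `e₁ > 0` with: for every
step `k ≥ 1`, `a ∈ [a₋, a₊]`, `0 ≤ m² ≤ m₊²`, every finite union `Ω` of `K`-blocks, every `A` regular (1.7) on `Ω` with
`0 < e ≤ e₁`, every direction `μ`, every pair `x ≠ x′` with `x + e_μ, x′ + e_μ ∈ Ω` and `32|x−x′|_∞ ≤ ηM` (lattice
units), every nearest-neighbour contour `Γ = (x, l)` to `x′` of length `≤ (d+1)|x−x′|_∞` staying within `|x−x′|_∞` of
`x`, the `R₀` restriction (every unit label within `K(d+4)` of the block of `x` is in `Ω`), every `f` supported at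
`ℓ^∞`-distance `≥ D` (fine units) from `x` with `‖f‖_{2,η} ≤ V‖f‖_∞`, and every colour `i`:
`(η^{-1}/|x−x′|_∞)^α·|(U(A(Γ))(D^η_{A,μ}G_k(Ω,A)f)(x′) − (D^η_{A,μ}G_k(Ω,A)f)(x))_i| ≤ c₀·V·exp(−D/(nK))·‖f‖_∞`
(`D^η_{A,μ} = B4Lemma21Region.regionDeriv`, `U(A(Γ)) = transport (fieldLink F (e/n) (acBond Ωc Ac)) x l`).
[cite: Balaban1983RegularityDecay, Theorem p.573 (1.9); (1.3)–(1.4) p.572; §2 pp.575–579 (2.2)–(2.22)] -/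
theorem thm19_holder_region (F : OrthFlow ι) {ℓ₁ : ℝ} (hℓ₁ : 0 ≤ ℓ₁)
    (hLip : ∀ t (v : ι → ℝ), ((F.U t - 1) *ᵥ v) ⬝ᵥ ((F.U t - 1) *ᵥ v) ≤ (ℓ₁ * t) ^ 2 * (v ⬝ᵥ v))
    (d ℓ : ℕ) (hℓ : 1 ≤ ℓ) (amin aplus m2plus : ℝ) (ha : 0 < amin) (α : ℝ) (hα0 : 0 ≤ α) (hα1 : α < 1) :
    ∃ K : ℕ, 16 ≤ K ∧ 8 ∣ K ∧ ∃ c₀ : ℝ, 0 < c₀ ∧ ∀ (creg β : ℝ), 0 ≤ creg → 0 < β →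
      ∃ e₁ : ℝ, 0 < e₁ ∧ ∀ (k : ℕ), 1 ≤ k → ∀ (hn : 1 ≤ (ℓ + 1) ^ k) (a m2 : ℝ),
      amin ≤ a → a ≤ aplus → 0 ≤ m2 → m2 ≤ m2plus →
      ∀ (Ωc : Finset (Fin (d + 1) → ℤ)), IsBlockUnion K Ωc →
      ∀ (Ac : (Fin (d + 1) → ℤ) → Fin (d + 1) → ℝ) (e : ℝ), 0 < e → e ≤ e₁ →
        (∀ x ∈ fineDom ((ℓ + 1) ^ k) Ωc, ∀ μ ν : Fin (d + 1),
          |Ac (x + e1 μ) ν - Ac x ν| ≤ creg * e ^ (β - 1) / ((ℓ + 1) ^ k : ℕ)) →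
      ∀ (μ : Fin (d + 1)) (x x' : ↥(fineDom ((ℓ + 1) ^ k) Ωc)), x.1 + e1 μ ∈ fineDom ((ℓ + 1) ^ k) Ωc →
        x'.1 + e1 μ ∈ fineDom ((ℓ + 1) ^ k) Ωc → x'.1 ≠ x.1 →
        32 * supNorm (x'.1 - x.1) ≤ (((ℓ + 1) ^ k : ℕ) : ℝ) * K →
      ∀ (l : List ↥(fineDom ((ℓ + 1) ^ k) Ωc)), IsNNChain x l → pathEnd x l = x' →
        (l.length : ℝ) ≤ ((d : ℝ) + 1) * supNorm (x'.1 - x.1) →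
        (∀ z ∈ l, supNorm (z.1 - x.1) ≤ supNorm (x'.1 - x.1)) →
        (∀ y : Fin (d + 1) → ℤ, (∀ ν, |y ν - blk ((ℓ + 1) ^ k) x.1 ν| ≤ (K : ℤ) * (d + 4)) → y ∈ Ωc) →
      ∀ (P : ↥(fineDom ((ℓ + 1) ^ k) Ωc) → Prop) [DecidablePred P] (D : ℝ),
        (∀ x', P x' → ∃ ν, D ≤ |rpos ((ℓ + 1) ^ k) Ωc x ν - rpos ((ℓ + 1) ^ k) Ωc x' ν|) →
      ∀ (f : ↥(fineDom ((ℓ + 1) ^ k) Ωc) × ι → ℝ), (∀ p, ¬ P p.1 → f p = 0) →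
      ∀ (V : ℝ), 1 ≤ V → lpv (vol d ℓ k)⁻¹ 2 f ≤ V * ‖f‖ →
      ∀ i : ι,
        ((((ℓ + 1) ^ k : ℕ) : ℝ) / supNorm (x'.1 - x.1)) ^ α *
          |(transport (fieldLink F (e / ((ℓ + 1) ^ k : ℕ)) (acBond Ωc Ac)) x l
              *ᵥ fld (regionDeriv F e ((ℓ + 1) ^ k) Ωc Ac μ
                    *ᵥ ((regionOp F e hn (B1.aSeq a ((ℓ : ℝ) + 1) k) m2 Ωc Ac)⁻¹ *ᵥ f)) x'
            - fld (regionDeriv F e ((ℓ + 1) ^ k) Ωc Ac μ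
                    *ᵥ ((regionOp F e hn (B1.aSeq a ((ℓ : ℝ) + 1) k) m2 Ωc Ac)⁻¹ *ᵥ f)) x) i|
          ≤ c₀ * V * Real.exp (-(D / ((((ℓ + 1) ^ k : ℕ) : ℝ) * K))) * ‖f‖ := by
  -- the constants of the per-cube inputs (Lemma 2.2 at `Ã_j`, (2.20), (2.21), the graded factor; Lemma 2.1)
  obtain ⟨C₁, hC₁, h₁⟩ := lemma22_sup_cubeField F hℓ₁ hLip d ℓ hℓ amin aplus m2plus ha
  obtain ⟨C₂, hC₂, h₂⟩ := eq220_cubeField_std F hℓ₁ hLip d ℓ hℓ amin aplus m2plus ha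
  have hp₁ : (d : ℝ) + 1 < 2 * ((d : ℝ) + 1) := by
    have : (0 : ℝ) ≤ d := Nat.cast_nonneg d
    linarith
  obtain ⟨C₃, hC₃, h₃⟩ := eq221_cubeField F hℓ₁ hLip d ℓ hℓ amin aplus m2plus ha hp₁
  obtain ⟨C₄, hC₄, h₄⟩ := eq221_psup_cubeField_std F hℓ₁ hLip d ℓ hℓ amin aplus m2plus ha hp₁
  obtain ⟨C₆, hC₆, h₆⟩ := lemma22_holder_cubeField F hℓ₁ hLip d ℓ hℓ amin aplus m2plus ha α hα0 hα1
  have hs : 0 ≤ ((d : ℝ) + 1) * (D1 hprof + D2 hprof) := by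
    have := D1_nonneg contDiff_hprof hasCompactSupport_hprof
    have := D2_nonneg contDiff_hprof hasCompactSupport_hprof
    positivity
  have hγ₀ : 0 < min 2 (3 / 4 * amin) / 4 := div_pos (lt_min two_pos (by linarith)) four_pos
  set C₅ : ℝ := (2 * ((d : ℝ) + 1) * (Real.sqrt (min 2 (3 / 4 * amin) / 4))⁻¹
      + (1 + |aplus|) * (min 2 (3 / 4 * amin) / 4)⁻¹) * (((d : ℝ) + 1) * (D1 hprof + D2 hprof)) with hC₅
  have hC₅0 : 0 ≤ C₅ := by
    have : 0 ≤ (Real.sqrt (min 2 (3 / 4 * amin) / 4))⁻¹ := inv_nonneg.2 (Real.sqrt_nonneg _)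
    have : 0 ≤ (min 2 (3 / 4 * amin) / 4)⁻¹ := inv_nonneg.2 hγ₀.le
    positivity
  set Cm : ℝ := C₂ + C₃ + C₄ + C₅ with hCm
  have hCm0 : 0 ≤ Cm := by positivity
  -- the cube size: `3^{d+1}·√N·C_max/K ≤ e^{−1}`, `8 ∣ K`
  set X : ℝ := (3 : ℝ) ^ (d + 1) * Real.sqrt (Fintype.card ι) * Cm * Real.exp 1 with hX
  have hX0 : 0 ≤ X := by positivity
  set K : ℕ := 16 * (⌈X⌉₊ + 1) with hK
  have hK16 : 16 ≤ K := by omega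
  have hK8 : 8 ≤ K := by omega
  have h8 : 8 ∣ K := ⟨2 * (⌈X⌉₊ + 1), by omega⟩
  have hK4 : 4 ∣ K := ⟨4 * (⌈X⌉₊ + 1), by omega⟩
  have hK2 : 2 ≤ K := by omega
  have hK1 : 1 ≤ K := by omega
  have hKr : (0 : ℝ) < K := by exact_mod_cast hK1
  have hKX : X ≤ K := by
    refine (Nat.le_ceil X).trans ?_
    rw [hK]
    push_cast
    linarith [(Nat.cast_nonneg ⌈X⌉₊ : (0 : ℝ) ≤ ⌈X⌉₊)]
  set cK : ℝ := Cm / K with hcK_def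
  have hcK : 0 ≤ cK := div_nonneg hCm0 hKr.le
  have h3 : (3 : ℝ) ^ (d + 1) * (Real.sqrt (Fintype.card ι) * cK) ≤ Real.exp (-1) := by
    have hexp : Real.exp 1 * Real.exp (-1) = 1 := by rw [← Real.exp_add]; norm_num
    have e : (3 : ℝ) ^ (d + 1) * (Real.sqrt (Fintype.card ι) * cK) = X / K * Real.exp (-1) := by
      rw [hcK_def, hX]
      calc (3 : ℝ) ^ (d + 1) * (Real.sqrt (Fintype.card ι) * (Cm / K))
          = (3 : ℝ) ^ (d + 1) * Real.sqrt (Fintype.card ι) * Cm / K * (Real.exp 1 * Real.exp (-1)) := by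
            rw [hexp]; ring
        _ = (3 : ℝ) ^ (d + 1) * Real.sqrt (Fintype.card ι) * Cm * Real.exp 1 / K * Real.exp (-1) := by ring
    rw [e]
    have : X / K ≤ 1 := div_le_one_of_le₀ hKX (Nat.cast_nonneg K)
    calc X / K * Real.exp (-1) ≤ 1 * Real.exp (-1) := mul_le_mul_of_nonneg_right this (Real.exp_pos _).le
      _ = Real.exp (-1) := one_mul _
  have hCle : ∀ {C : ℝ}, C ≤ Cm → C / K ≤ cK := fun h => div_le_div_of_nonneg_right h hKr.le
  have hC₂le : C₂ / K ≤ cK := hCle (by rw [hCm]; linarith)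
  have hC₃le : C₃ / K ≤ cK := hCle (by rw [hCm]; linarith)
  have hC₄le : C₄ / K ≤ cK := hCle (by rw [hCm]; linarith)
  have hC₅le : C₅ / K ≤ cK := hCle (by rw [hCm]; linarith)
  -- the constant `c₀`
  set c₀ : ℝ := 2 ^ (d + 4) * Real.exp (5 / 2)
      * (Real.sqrt (Fintype.card ι) * (C₆ + ((d : ℝ) + 1) * D1 hprof * C₁
          + ((d : ℝ) + 3) * (((d : ℝ) + 1) * (D1 hprof + D2 hprof)) * C₁
          + ((d : ℝ) + 1) * (D1 hprof ^ 2 + D2 hprof) * C₁)) + 1 with hc₀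
  have hD1 := D1_nonneg contDiff_hprof hasCompactSupport_hprof
  have hD2 := D2_nonneg contDiff_hprof hasCompactSupport_hprof
  have hc₀0 : 0 < c₀ := by positivity
  refine ⟨K, hK16, h8, c₀, hc₀0, fun creg β hcreg hβ => ?_⟩
  -- «for e sufficiently small»
  obtain ⟨e₁, he₁, h₁'⟩ := h₁ creg β hcreg hβ (2 * K) K hK1
  obtain ⟨e₂, he₂, h₂'⟩ := h₂ creg β hcreg hβ K hK2
  obtain ⟨e₃, he₃, h₃'⟩ := h₃ creg β hcreg hβ (2 * K) K hK2
  obtain ⟨e₄, he₄, h₄'⟩ := h₄ creg β hcreg hβ K hK2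
  obtain ⟨e₅, he₅, h₅'⟩ := cubeField_threshold d (c := 0) (aplus := aplus) hℓ₁ le_rfl ha hcreg hβ 1 K
  obtain ⟨e₆, he₆, h₆'⟩ := h₆ creg β hcreg hβ (2 * K) K hK1
  refine ⟨min (min (min (min e₁ e₂) (min e₃ e₄)) e₅) e₆,
    lt_min (lt_min (lt_min (lt_min he₁ he₂) (lt_min he₃ he₄)) he₅) he₆, ?_⟩
  intro k hk hn a m2 ea1 ea2 em1 em2 Ωc hΩ Ac e he hle' h17 μ x x' hxμ hx'μ hne hclose l hl hlend hlen hlnear hxR P _ D hD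
    f hfP V hV hfV i
  have hle : e ≤ min (min (min e₁ e₂) (min e₃ e₄)) e₅ := hle'.trans (min_le_left _ _)
  have hle₆ : e ≤ e₆ := hle'.trans (min_le_right _ _)
  have hle₁ : e ≤ e₁ := hle.trans ((min_le_left _ _).trans ((min_le_left _ _).trans (min_le_left _ _)))
  have hle₂ : e ≤ e₂ := hle.trans ((min_le_left _ _).trans ((min_le_left _ _).trans (min_le_right _ _)))
  have hle₃ : e ≤ e₃ := hle.trans ((min_le_left _ _).trans ((min_le_right _ _).trans (min_le_left _ _)))
  have hle₄ : e ≤ e₄ := hle.trans ((min_le_left _ _).trans ((min_le_right _ _).trans (min_le_right _ _)))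
  have hle₅ : e ≤ e₅ := hle.trans (min_le_right _ _)
  have hn2 : 2 ≤ (ℓ + 1) ^ k := by
    calc 2 ≤ ℓ + 1 := by omega
      _ = (ℓ + 1) ^ 1 := (pow_one _).symm
      _ ≤ (ℓ + 1) ^ k := Nat.pow_le_pow_right (Nat.succ_pos ℓ) hk
  have hnK : 16 ≤ (ℓ + 1) ^ k * K := le_trans (by norm_num) (Nat.mul_le_mul hn2 hK8)
  have hnK3 : 3 ≤ (ℓ + 1) ^ k * K := le_trans (by norm_num) hnK
  have ha' : 0 < a := lt_of_lt_of_le ha ea1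
  have hL : (1 : ℝ) < (ℓ : ℝ) + 1 := by
    have : (1 : ℝ) ≤ ℓ := by exact_mod_cast hℓ
    linarith
  have hak : 0 < B1.aSeq a ((ℓ : ℝ) + 1) k := B1.aSeq_pos ha' hL hk
  obtain ⟨hak1, hak2⟩ := aSeq_window hℓ hk ha ea1 ea2
  have hvol : 0 ≤ (vol d ℓ k)⁻¹ ^ (2 : ℝ)⁻¹ := Real.rpow_nonneg (inv_nonneg.2 (vol_pos d ℓ k).le) _
  -- the standard box data
  have hM1 : ∀ _i : Fin (d + 1), 1 ≤ 2 * K := fun _ => by omega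
  have hMS : ∀ _i : Fin (d + 1), 2 * K ≤ 2 * K := fun _ => le_rfl
  have hKM : ∀ _i : Fin (d + 1), K ∣ 2 * K := fun _ => Dvd.intro_left 2 rfl
  have hj1 : ∀ _i : Fin (d + 1), (1 : ℤ) ≤ 1 := fun _ => le_rfl
  have hj2 : ∀ _i : Fin (d + 1), (K : ℤ) * (1 + 1) ≤ ((2 * K : ℕ) : ℤ) := fun _ => by push_cast; omega
  -- the main chain with the inputs discharged
  have main := thm19_holder_region_of_inputs F (e / ((ℓ + 1) ^ k : ℕ)) hℓ hk hn Ωc hK16 hK4 ha' em1 Ac hC₁.le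
    hcK (n₀ := d + 1) (Nat.succ_pos d)
    -- Lemma 2.2 (2.17), sup member, at `Ã_j`
    (fun j hj Φ => (h₁' k hk hn hnK a m2 ea1 ea2 em1 em2 (fun _ => 2 * K) hM1 hMS (fun _ => 1) hj1 hj2
      (AcS ℓ k K Ac j) e he hle₁ (regular_AcS h17 hj) Φ).1)
    -- (2.20)
    (fun j hj Φ => (h₂' k hk hn hnK a m2 ea1 ea2 em1 em2 (AcS ℓ k K Ac j) e he hle₂ (regular_AcS h17 hj) Φ).trans
      (mul_le_mul_of_nonneg_right hC₂le (supN_nonneg Φ)))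
    -- the graded factor `‖·‖_{∞,p₁}` of (2.21)
    (fun j hj p hp Φ => by
      have hp' : 2 * ((d : ℝ) + 1) ≤ p := by push_cast at hp; linarith
      exact (h₄' k hk hn hnK a m2 ea1 ea2 em1 em2 (AcS ℓ k K Ac j) e he hle₄ (regular_AcS h17 hj) p hp' Φ).trans
        (mul_le_mul_of_nonneg_right hC₄le (lpW_nonneg d ℓ k p Φ)))
    -- (2.21)
    (fun j hj p q hp hpq hdiff Φ => by
      have hdiff' : p⁻¹ - q⁻¹ ≤ (2 * ((d : ℝ) + 1))⁻¹ := by push_cast at hdiff; exact hdiff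
      exact (h₃' k hk hn hnK a m2 ea1 ea2 em1 em2 (fun _ => 2 * K) hM1 hMS hKM (fun _ => 1) hj1 hj2
        (AcS ℓ k K Ac j) e he hle₃ (regular_AcS h17 hj) p q hp hpq hdiff' Φ).trans
        (mul_le_mul_of_nonneg_right hC₃le (lpW_nonneg d ℓ k p Φ)))
    -- Lemma 2.1's `‖·‖_{2,2}` at every cube, on the sub-region `Ω ∩ □̂_j`
    (fun j Φ => by
      obtain ⟨_, hsm, _⟩ := h₅' e he hle₅ _ hak1 hak2
      have hsmall : ℓ₁ ^ 2 * (((d : ℝ) + 1) * creg * e ^ β) ^ 2 * ((d : ℝ) + 1)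
          * (1 + B1.aSeq a ((ℓ : ℝ) + 1) k * ((d : ℝ) + 1)) ≤ min 2 (B1.aSeq a ((ℓ : ℝ) + 1) k) / 4 := by
        simpa only [Nat.cast_one, mul_one] using hsm
      have hL := eq221_l2_region_hZ F hℓ₁ hLip he hn hak em1 (subLabels Ωc K j) hcreg
        (fun y hy => h17 y (fineDom_mono hn (subLabels_subset Ωc K j) hy)) hsmall hnK3
        (isBlockUnion_subLabels Ωc hK1 hΩ j) j Φ
      have step : lpM 2 (kOpR F e hn (B1.aSeq a ((ℓ : ℝ) + 1) k) m2 (subLabels Ωc K j) Ac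
            (fun x => hZ ((ℓ + 1) ^ k) K j x.1)
          *ᵥ ((regionOp F e hn (B1.aSeq a ((ℓ : ℝ) + 1) k) m2 (subLabels Ωc K j) Ac)⁻¹
            *ᵥ (mulH (ι := ι) (fun x : ↥(fineDom ((ℓ + 1) ^ k) (subLabels Ωc K j)) => hZ ((ℓ + 1) ^ k) K j x.1)
              *ᵥ Φ))) ≤ cK * lpM 2 Φ := by
        refine hL.trans (mul_le_mul_of_nonneg_right ?_ (lpM_nonneg 2 Φ))
        refine le_trans ?_ hC₅le
        rw [hC₅]
        calc (2 * ((d : ℝ) + 1) * (Real.sqrt (min 2 (B1.aSeq a ((ℓ : ℝ) + 1) k) / 4 + m2))⁻¹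
              + (1 + B1.aSeq a ((ℓ : ℝ) + 1) k) * (min 2 (B1.aSeq a ((ℓ : ℝ) + 1) k) / 4 + m2)⁻¹)
              * (((d : ℝ) + 1) * (D1 hprof + D2 hprof)) / K
            = (2 * ((d : ℝ) + 1) * (Real.sqrt (min 2 (B1.aSeq a ((ℓ : ℝ) + 1) k) / 4 + m2))⁻¹
              + (1 + B1.aSeq a ((ℓ : ℝ) + 1) k) * (min 2 (B1.aSeq a ((ℓ : ℝ) + 1) k) / 4 + m2)⁻¹)
              * (((d : ℝ) + 1) * (D1 hprof + D2 hprof)) * (K : ℝ)⁻¹ := div_eq_mul_inv _ _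
          _ ≤ (2 * ((d : ℝ) + 1) * (Real.sqrt (min 2 (3 / 4 * amin) / 4))⁻¹
              + (1 + |aplus|) * (min 2 (3 / 4 * amin) / 4)⁻¹) * (((d : ℝ) + 1) * (D1 hprof + D2 hprof))
              * (K : ℝ)⁻¹ := mul_le_mul_of_nonneg_right (l2_const_le d ha hak1 hak2 em1 hs) (inv_nonneg.2 hKr.le)
          _ = _ := (div_eq_mul_inv _ _).symm
      show (vol d ℓ k)⁻¹ ^ (2 : ℝ)⁻¹ * lpM 2 _ ≤ cK * ((vol d ℓ k)⁻¹ ^ (2 : ℝ)⁻¹ * lpM 2 Φ)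
      calc (vol d ℓ k)⁻¹ ^ (2 : ℝ)⁻¹ * lpM 2 _ ≤ (vol d ℓ k)⁻¹ ^ (2 : ℝ)⁻¹ * (cK * lpM 2 Φ) :=
            mul_le_mul_of_nonneg_left step hvol
        _ = cK * ((vol d ℓ k)⁻¹ ^ (2 : ℝ)⁻¹ * lpM 2 Φ) := by ring)
    hC₁.le hC₆.le μ
    -- Lemma 2.2 (2.17), derivative sup members, at `Ã_j`
    (fun j hj ν Φ => ((h₁' k hk hn hnK a m2 ea1 ea2 em1 em2 (fun _ => 2 * K) hM1 hMS (fun _ => 1) hj1 hj2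
      (AcS ℓ k K Ac j) e he hle₁ (regular_AcS h17 hj) Φ).2 ν))
    hα0 hα1.le
    -- Lemma 2.2 (2.16), the Hölder member, at `Ã_j`
    (fun j hj a0 a0' ha0μ ha0'μ hneB lB hlB hlendB hlenB Φ =>
      h₆' k hk hn hnK a m2 ea1 ea2 em1 em2 (fun _ => 2 * K) hM1 hMS (fun _ => 1) hj1 hj2 (AcS ℓ k K Ac j) e he hle₆
        (regular_AcS h17 hj) μ a0 ⟨a0.1 + e1 μ, ha0μ⟩ a0' ⟨a0'.1 + e1 μ, ha0'μ⟩ rfl rfl hneB lB hlB hlendB hlenB Φ)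
    h3 x x' hxμ hx'μ hne hclose l hl hlend hlen hlnear
    (fun y hy => hxR y fun ν => by have h := hy ν; push_cast at h ⊢; linarith)
    P hD f hfP hV hfV i
  have hreg : regionOp F e hn (B1.aSeq a ((ℓ : ℝ) + 1) k) m2 Ωc Ac
      = covOp (regWt ((ℓ + 1) ^ k) (fineDom ((ℓ + 1) ^ k) Ωc)) m2
          (B1.aSeq a ((ℓ : ℝ) + 1) k * (((((ℓ + 1) ^ k : ℕ)) : ℝ) ^ (d + 1))⁻¹)
          (rBlkWt ((ℓ + 1) ^ k) Ωc (fineDom ((ℓ + 1) ^ k) Ωc)) (fieldLink F (e / ((ℓ + 1) ^ k : ℕ)) (acBond Ωc Ac))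
          (contourTrans (fieldLink F (e / ((ℓ + 1) ^ k : ℕ)) (acBond Ωc Ac)) (rbaseEmb hn Ωc)
            (rstairContour hn Ωc)) := rfl
  have hder : regionDeriv F e ((ℓ + 1) ^ k) Ωc Ac μ
      = covDeriv ((ℓ + 1) ^ k) (fineDom ((ℓ + 1) ^ k) Ωc) (fieldLink F (e / ((ℓ + 1) ^ k : ℕ)) (acBond Ωc Ac)) μ :=
    rfl
  rw [hreg, hder]
  have hV0 : 0 ≤ V := zero_le_one.trans hV
  refine main.trans ?_
  have hrest : 0 ≤ V * Real.exp (-(D / ((((ℓ + 1) ^ k : ℕ) : ℝ) * K))) * ‖f‖ := by positivity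
  have hle : 2 ^ (d + 4) * Real.exp (5 / 2)
        * (Real.sqrt (Fintype.card ι) * (C₆ + ((d : ℝ) + 1) * D1 hprof * C₁
            + ((d : ℝ) + 3) * (((d : ℝ) + 1) * (D1 hprof + D2 hprof)) * C₁
            + ((d : ℝ) + 1) * (D1 hprof ^ 2 + D2 hprof) * C₁)) ≤ c₀ := by
    rw [hc₀]; linarith
  calc 2 ^ (d + 4) * Real.exp (5 / 2)
        * (Real.sqrt (Fintype.card ι) * (C₆ + ((d : ℝ) + 1) * D1 hprof * C₁
            + ((d : ℝ) + 3) * (((d : ℝ) + 1) * (D1 hprof + D2 hprof)) * C₁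
            + ((d : ℝ) + 1) * (D1 hprof ^ 2 + D2 hprof) * C₁))
        * V * Real.exp (-(D / ((((ℓ + 1) ^ k : ℕ) : ℝ) * K))) * ‖f‖
      = (2 ^ (d + 4) * Real.exp (5 / 2)
        * (Real.sqrt (Fintype.card ι) * (C₆ + ((d : ℝ) + 1) * D1 hprof * C₁
            + ((d : ℝ) + 3) * (((d : ℝ) + 1) * (D1 hprof + D2 hprof)) * C₁
            + ((d : ℝ) + 1) * (D1 hprof ^ 2 + D2 hprof) * C₁)))
        * (V * Real.exp (-(D / ((((ℓ + 1) ^ k : ℕ) : ℝ) * K))) * ‖f‖) := by ring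
    _ ≤ c₀ * (V * Real.exp (-(D / ((((ℓ + 1) ^ k : ℕ) : ℝ) * K))) * ‖f‖) := mul_le_mul_of_nonneg_right hle hrest
    _ = c₀ * V * Real.exp (-(D / ((((ℓ + 1) ^ k : ℕ) : ℝ) * K))) * ‖f‖ := by ring

/-- **THEOREM (1.9), Hölder member, GENERAL `Ω` UNDER `R₀`, CLOSE PAIRS, FOR `f` SUPPORTED IN ONE UNIT BLOCK** — the
print's reduction «it is sufficient to prove the Proposition for a function f with support in a unit cube» (pp. 574–575) applied
to `thm19_holder_region` (`‖f‖_{2,η} ≤ √N‖f‖_∞`, `B4Thm110RegionLp.lpv_two_le_unitBlock`).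
[cite: Balaban1983RegularityDecay, Theorem p.573 (1.9), §2 ¶1 p.575] -/
theorem thm19_holder_region_unitBlock (F : OrthFlow ι) {ℓ₁ : ℝ} (hℓ₁ : 0 ≤ ℓ₁)
    (hLip : ∀ t (v : ι → ℝ), ((F.U t - 1) *ᵥ v) ⬝ᵥ ((F.U t - 1) *ᵥ v) ≤ (ℓ₁ * t) ^ 2 * (v ⬝ᵥ v))
    (d ℓ : ℕ) (hℓ : 1 ≤ ℓ) (amin aplus m2plus : ℝ) (ha : 0 < amin) (α : ℝ) (hα0 : 0 ≤ α) (hα1 : α < 1) :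
    ∃ K : ℕ, 16 ≤ K ∧ 8 ∣ K ∧ ∃ c₀ : ℝ, 0 < c₀ ∧ ∀ (creg β : ℝ), 0 ≤ creg → 0 < β →
      ∃ e₁ : ℝ, 0 < e₁ ∧ ∀ (k : ℕ), 1 ≤ k → ∀ (hn : 1 ≤ (ℓ + 1) ^ k) (a m2 : ℝ),
      amin ≤ a → a ≤ aplus → 0 ≤ m2 → m2 ≤ m2plus →
      ∀ (Ωc : Finset (Fin (d + 1) → ℤ)), IsBlockUnion K Ωc →
      ∀ (Ac : (Fin (d + 1) → ℤ) → Fin (d + 1) → ℝ) (e : ℝ), 0 < e → e ≤ e₁ →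
        (∀ x ∈ fineDom ((ℓ + 1) ^ k) Ωc, ∀ μ ν : Fin (d + 1),
          |Ac (x + e1 μ) ν - Ac x ν| ≤ creg * e ^ (β - 1) / ((ℓ + 1) ^ k : ℕ)) →
      ∀ (μ : Fin (d + 1)) (x x' : ↥(fineDom ((ℓ + 1) ^ k) Ωc)), x.1 + e1 μ ∈ fineDom ((ℓ + 1) ^ k) Ωc →
        x'.1 + e1 μ ∈ fineDom ((ℓ + 1) ^ k) Ωc → x'.1 ≠ x.1 →
        32 * supNorm (x'.1 - x.1) ≤ (((ℓ + 1) ^ k : ℕ) : ℝ) * K →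
      ∀ (l : List ↥(fineDom ((ℓ + 1) ^ k) Ωc)), IsNNChain x l → pathEnd x l = x' →
        (l.length : ℝ) ≤ ((d : ℝ) + 1) * supNorm (x'.1 - x.1) →
        (∀ z ∈ l, supNorm (z.1 - x.1) ≤ supNorm (x'.1 - x.1)) →
        (∀ y : Fin (d + 1) → ℤ, (∀ ν, |y ν - blk ((ℓ + 1) ^ k) x.1 ν| ≤ (K : ℤ) * (d + 4)) → y ∈ Ωc) →
      ∀ (y₀ : Fin (d + 1) → ℤ) (D : ℝ),
        (∀ x'' : ↥(fineDom ((ℓ + 1) ^ k) Ωc), blk ((ℓ + 1) ^ k) x''.1 = y₀ →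
          ∃ ν, D ≤ |rpos ((ℓ + 1) ^ k) Ωc x ν - rpos ((ℓ + 1) ^ k) Ωc x'' ν|) →
      ∀ (f : ↥(fineDom ((ℓ + 1) ^ k) Ωc) × ι → ℝ), (∀ p, blk ((ℓ + 1) ^ k) p.1.1 ≠ y₀ → f p = 0) →
      ∀ i : ι,
        ((((ℓ + 1) ^ k : ℕ) : ℝ) / supNorm (x'.1 - x.1)) ^ α *
          |(transport (fieldLink F (e / ((ℓ + 1) ^ k : ℕ)) (acBond Ωc Ac)) x l
              *ᵥ fld (regionDeriv F e ((ℓ + 1) ^ k) Ωc Ac μ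
                    *ᵥ ((regionOp F e hn (B1.aSeq a ((ℓ : ℝ) + 1) k) m2 Ωc Ac)⁻¹ *ᵥ f)) x'
            - fld (regionDeriv F e ((ℓ + 1) ^ k) Ωc Ac μ
                    *ᵥ ((regionOp F e hn (B1.aSeq a ((ℓ : ℝ) + 1) k) m2 Ωc Ac)⁻¹ *ᵥ f)) x) i|
          ≤ c₀ * Real.exp (-(D / ((((ℓ + 1) ^ k : ℕ) : ℝ) * K))) * ‖f‖ := by
  classical
  obtain ⟨K, hK16, h8, c₀, hc₀, H⟩ := thm19_holder_region F hℓ₁ hLip d ℓ hℓ amin aplus m2plus ha α hα0 hα1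
  refine ⟨K, hK16, h8, c₀ * max (Real.sqrt (Fintype.card ι)) 1, by positivity, fun creg β hcreg hβ => ?_⟩
  obtain ⟨e₁, he₁, H'⟩ := H creg β hcreg hβ
  refine ⟨e₁, he₁, ?_⟩
  intro k hk hn a m2 ea1 ea2 em1 em2 Ωc hΩ Ac e he hle h17 μ x x' hxμ hx'μ hne hclose l hl hlend hlen hlnear hxR y₀ D hD
    f hf i
  have hV : (1 : ℝ) ≤ max (Real.sqrt (Fintype.card ι)) 1 := le_max_right _ _
  have hfV : lpv (vol d ℓ k)⁻¹ 2 f ≤ max (Real.sqrt (Fintype.card ι)) 1 * ‖f‖ :=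
    (lpv_two_le_unitBlock hn y₀ f hf).trans (mul_le_mul_of_nonneg_right (le_max_left _ _) (norm_nonneg f))
  have h := H' k hk hn a m2 ea1 ea2 em1 em2 Ωc hΩ Ac e he hle h17 μ x x' hxμ hx'μ hne hclose l hl hlend hlen hlnear hxR
    (fun x'' => blk ((ℓ + 1) ^ k) x''.1 = y₀) D hD f (fun p hp => hf p hp) _ hV hfV i
  refine h.trans (le_of_eq ?_)
  ring

end Main

end

end Literature.MathematicalPhysics.QuantumFieldTheory.Balaban1983to89.B4Thm19RegionLp
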